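import Literature.MeasureTheory.Group.PadicIntHaarScaling
import Mathlib.LinearAlgebra.FreeModule.PID
import Mathlib.LinearAlgebra.Determinant
import Mathlib.LinearAlgebra.Matrix.ToLinearEquiv
import Mathlib.Topology.Algebra.Module.Basic
import HarnessLib

/-!
# The Haar measure of `ℤ_pⁿ` under `ℤ_p`-linear maps: `μ(T(S)) = |det T|_p · μ(S)`

Topic `Literature/MeasureTheory/Group`; continues `PadicIntHaarScaling.lean`
(`μ(T(S)) = μ(T(ℤ_pⁿ)) μ(S)` for continuous injective additive endomorphisms `T` of `ℤ_pⁿ`,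
`μ_p(aℤ_p) = |a|_p`). Everything here is PROVED (no named facts).

* `padicInt_pi_volume_range_linearMap` — **`μ(T(ℤ_pⁿ)) = |det T|_p`** for an injective
  `ℤ_p`-linear endomorphism `T` of `ℤ_pⁿ = ι → ℤ_[p]`: by the Smith normal form over the principal
  ideal domain `ℤ_p` (Mathlib `Submodule.exists_smith_normal_form_of_rank_eq`) there is a basis
  `b'` of `ℤ_pⁿ` and `aᵢ ≠ 0` with `T(ℤ_pⁿ) = ⊕ aᵢℤ_p b'ᵢ`; in the coordinates `b'` (a continuous
  additive automorphism, which preserves `μ`) this is the box `∏ aᵢℤ_p` of measure `∏ |aᵢ|_p`, and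
  `det T` is associated with `∏ aᵢ` (as in Mathlib's `Submodule.natAbs_det_equiv` over `ℤ`).
* `padicInt_pi_volume_image_linearMap` — **`μ(T(S)) = |det T|_p μ(S)`** for every `S ⊆ ℤ_pⁿ`;
  `padicInt_pi_volume_image_mulVec` — the same for `v ↦ A v`, `A ∈ Mₙ(ℤ_p)`, `det A ≠ 0`
  (the module of a linear map of `ℚ_pⁿ` is `|det|_p`: Weil, *Basic Number Theory*, Ch. I §2,
  Cor. 3 of Thm. 3; the `p`-adic volume scalings of Bhargava–Shankar, Ann. of Math. 181 (2015),
  §2.5 and §3.4 of the published version).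

## References

* A. Weil, *Basic Number Theory*, Ch. I §2; N. Bourbaki, *Intégration*, Ch. VII §1 no. 10–11. [folklore]
* M. Bhargava, A. Shankar, Ann. of Math. (2) 181 (2015) 191–242, §2.5, §3.4 (published numbering).
  [cite: BhargavaShankarAnnals2015, §2.5 (scaling of p-adic volumes; arXiv:1006.1002v2 numbering)]
-/

noncomputable section

open MeasureTheory MeasureTheory.Measure Set Module
open scoped ENNReal NNReal

namespace Literature.MeasureTheory.Group

variable {p : ℕ} [Fact p.Prime] {ι : Type*} [Fintype ι]

/-- Associated elements of `ℤ_p` have the same absolute value. [folklore] -/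
theorem padicInt_nnnorm_eq_of_associated {x y : ℤ_[p]} (h : Associated x y) : ‖x‖₊ = ‖y‖₊ := by
  obtain ⟨u, rfl⟩ := h
  have hu : ‖(u : ℤ_[p])‖ = 1 := PadicInt.isUnit_iff.mp (Units.isUnit u)
  apply NNReal.eq
  simp only [coe_nnnorm, norm_mul, hu, mul_one]

/-- In coordinates with respect to a basis `b'`, the submodule spanned by the `aᵢ • b'ᵢ` is the box
`{c : ∀ i, aᵢ ∣ cᵢ}`. [folklore] -/
theorem mem_of_smith_iff {M : Type*} [AddCommGroup M] [Module ℤ_[p] M] {N : Submodule ℤ_[p] M}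
    (b' : Basis ι ℤ_[p] M) (a : ι → ℤ_[p]) (ab : Basis ι ℤ_[p] N)
    (hab : ∀ i, (ab i : M) = a i • b' i) (x : M) :
    x ∈ N ↔ ∀ i, a i ∣ b'.repr x i := by
  classical
  rw [ab.mem_submodule_iff']
  constructor
  · rintro ⟨c, rfl⟩ i
    have hx : ∑ j, c j • (ab j : M) = ∑ j, (c j * a j) • b' j :=
      Finset.sum_congr rfl fun j _ ↦ by rw [hab, smul_smul]
    rw [hx, b'.repr_sum_self]
    exact ⟨c i, mul_comm _ _⟩
  · intro h
    choose d hd using h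
    refine ⟨d, ?_⟩
    calc x = ∑ i, b'.repr x i • b' i := (b'.sum_repr x).symm
      _ = ∑ i, d i • (ab i : M) := Finset.sum_congr rfl fun i _ ↦ by
          rw [hd i, hab i, smul_smul, mul_comm]

/-- **`μ(T(ℤ_pⁿ)) = |det T|_p`** for an injective `ℤ_p`-linear endomorphism `T` of `ℤ_pⁿ` (Smith
normal form over `ℤ_p`). [folklore] -/
theorem padicInt_pi_volume_range_linearMap (T : (ι → ℤ_[p]) →ₗ[ℤ_[p]] (ι → ℤ_[p]))
    (hinj : Function.Injective T) :
    volume (range T) = (‖LinearMap.det T‖₊ : ℝ≥0∞) := by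
  classical
  set N : Submodule ℤ_[p] (ι → ℤ_[p]) := LinearMap.range T with hN
  let e : (ι → ℤ_[p]) ≃ₗ[ℤ_[p]] N := LinearEquiv.ofInjective T hinj
  have hrank : finrank ℤ_[p] N = finrank ℤ_[p] (ι → ℤ_[p]) := e.finrank_eq.symm
  obtain ⟨b', a, ab, hab⟩ :=
    Submodule.exists_smith_normal_form_of_rank_eq (Pi.basisFun ℤ_[p] ι) hrank (N := N)
  have ha : ∀ i, a i ≠ 0 := by
    intro i hi
    apply ab.ne_zero i
    apply Subtype.ext
    rw [hab i, hi, zero_smul, Submodule.coe_zero]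
  -- (1) the range in the coordinates `b'` is the box `∏ aᵢ ℤ_p`
  let φ : (ι → ℤ_[p]) ≃ₗ[ℤ_[p]] (ι → ℤ_[p]) := b'.equivFun
  have hφN : (φ : (ι → ℤ_[p]) → (ι → ℤ_[p])) '' (N : Set (ι → ℤ_[p])) =
      Set.pi univ (fun i ↦ range fun x : ℤ_[p] ↦ a i * x) := by
    ext c
    simp only [mem_image, SetLike.mem_coe, mem_univ_pi, mem_range]
    constructor
    · rintro ⟨x, hx, rfl⟩ i
      obtain ⟨d, hd⟩ := (mem_of_smith_iff b' a ab hab x).mp hx i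
      exact ⟨d, by rw [Basis.equivFun_apply, hd]⟩
    · intro hc
      refine ⟨φ.symm c, ?_, φ.apply_symm_apply c⟩
      refine (mem_of_smith_iff b' a ab hab _).mpr fun i ↦ ?_
      obtain ⟨d, hd⟩ := hc i
      refine ⟨d, ?_⟩
      have : b'.repr (φ.symm c) i = c i := by
        rw [← Basis.equivFun_apply, LinearEquiv.apply_symm_apply]
      rw [this, ← hd]
  have hvolN : volume (N : Set (ι → ℤ_[p])) = ∏ i, ((p : ℝ≥0∞) ^ (a i).valuation)⁻¹ := by
    have hcont : Continuous (φ : (ι → ℤ_[p]) → (ι → ℤ_[p])) :=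
      LinearMap.continuous_on_pi (φ : (ι → ℤ_[p]) →ₗ[ℤ_[p]] (ι → ℤ_[p]))
    have h : volume ((φ : (ι → ℤ_[p]) → (ι → ℤ_[p])) '' (N : Set (ι → ℤ_[p]))) =
        volume (N : Set (ι → ℤ_[p])) :=
      padicInt_pi_volume_image_addEquiv (p := p) φ.toAddEquiv hcont (N : Set (ι → ℤ_[p]))
    rw [hφN] at h
    rw [← h, volume_pi, Measure.pi_pi]
    exact Finset.prod_congr rfl fun i _ ↦ padicInt_volume_range_mulLeft (ha i)
  -- (2) `det T` is associated with `∏ aᵢ`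
  let e' : (ι → ℤ_[p]) ≃ₗ[ℤ_[p]] N := b'.equiv ab (Equiv.refl _)
  let f : (ι → ℤ_[p]) →ₗ[ℤ_[p]] (ι → ℤ_[p]) := N.subtype ∘ₗ (e' : (ι → ℤ_[p]) →ₗ[ℤ_[p]] N)
  have hf : ∀ i, f (b' i) = a i • b' i := by
    intro i
    show ((b'.equiv ab (Equiv.refl _)) (b' i) : ι → ℤ_[p]) = a i • b' i
    rw [b'.equiv_apply, Equiv.refl_apply]
    exact hab i
  have hdetf : LinearMap.det f = ∏ i, a i := by
    rw [← LinearMap.det_toMatrix b', show LinearMap.toMatrix b' b' f = Matrix.diagonal a from ?_,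
      Matrix.det_diagonal]
    ext i j
    rw [LinearMap.toMatrix_apply, hf, map_smul, Basis.repr_self, Finsupp.smul_single,
      smul_eq_mul, mul_one]
    by_cases h : i = j
    · rw [h, Matrix.diagonal_apply_eq, Finsupp.single_eq_same]
    · rw [Matrix.diagonal_apply_ne _ h, Finsupp.single_eq_of_ne h]
  have hTe : T = N.subtype ∘ₗ (e : (ι → ℤ_[p]) →ₗ[ℤ_[p]] N) := by
    refine LinearMap.ext fun x ↦ ?_
    rfl
  have hassoc : Associated (LinearMap.det T) (∏ i, a i) := by
    rw [hTe, ← hdetf]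
    exact LinearMap.associated_det_comp_equiv N.subtype e e'
  -- (3) assemble
  have hrangeN : range T = (N : Set (ι → ℤ_[p])) := by rw [hN, LinearMap.coe_range]
  rw [hrangeN, hvolN, padicInt_nnnorm_eq_of_associated hassoc, nnnorm_prod]
  push_cast
  exact Finset.prod_congr rfl fun i _ ↦ (ennnorm_eq_inv_pow_valuation (ha i)).symm

/-- **`μ(T(S)) = |det T|_p · μ(S)`** for an injective `ℤ_p`-linear endomorphism `T` of `ℤ_pⁿ` and
every `S ⊆ ℤ_pⁿ`: the Haar measure of `ℤ_pⁿ` transforms under linear maps by the module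
`|det|_p` (Weil, *Basic Number Theory*, Ch. I §2). [folklore] -/
theorem padicInt_pi_volume_image_linearMap (T : (ι → ℤ_[p]) →ₗ[ℤ_[p]] (ι → ℤ_[p]))
    (hinj : Function.Injective T) (S : Set (ι → ℤ_[p])) :
    volume (T '' S) = (‖LinearMap.det T‖₊ : ℝ≥0∞) * volume S := by
  have h := padicInt_pi_volume_image_eq T.toAddMonoidHom (LinearMap.continuous_on_pi T) hinj S
  rw [LinearMap.toAddMonoidHom_coe] at h
  rw [h, padicInt_pi_volume_range_linearMap T hinj]

/-- A matrix over `ℤ_p` with nonzero determinant acts injectively on `ℤ_pⁿ`. [folklore] -/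
theorem padicInt_mulVec_injective [DecidableEq ι] {A : Matrix ι ι ℤ_[p]} (hA : A.det ≠ 0) :
    Function.Injective (fun v : ι → ℤ_[p] ↦ A.mulVec v) := by
  intro v w h
  have h' : A.mulVec v = A.mulVec w := h
  by_contra hvw
  have hne : v - w ≠ 0 := sub_ne_zero.mpr hvw
  have hzero : A.mulVec (v - w) = 0 := by rw [Matrix.mulVec_sub, h', sub_self]
  exact hA (Matrix.exists_mulVec_eq_zero_iff.mp ⟨v - w, hne, hzero⟩)

/-- **`μ(A·S) = |det A|_p · μ(S)`** for `A ∈ Mₙ(ℤ_p)` with `det A ≠ 0` and every `S ⊆ ℤ_pⁿ`.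
[folklore] -/
theorem padicInt_pi_volume_image_mulVec [DecidableEq ι] {A : Matrix ι ι ℤ_[p]} (hA : A.det ≠ 0)
    (S : Set (ι → ℤ_[p])) :
    volume ((fun v : ι → ℤ_[p] ↦ A.mulVec v) '' S) = (‖A.det‖₊ : ℝ≥0∞) * volume S := by
  have hinj : Function.Injective (Matrix.toLin' A) := fun v w hvw ↦
    padicInt_mulVec_injective hA (by simpa [Matrix.toLin'_apply] using hvw)
  have h := padicInt_pi_volume_image_linearMap (Matrix.toLin' A) hinj S
  rw [LinearMap.det_toLin'] at h
  have hfun : (fun v : ι → ℤ_[p] ↦ A.mulVec v) = (Matrix.toLin' A : (ι → ℤ_[p]) → (ι → ℤ_[p])) :=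
    funext fun v ↦ (Matrix.toLin'_apply A v).symm
  rw [hfun, h]

/-- In particular `μ(A·ℤ_pⁿ) = |det A|_p`: the index of the lattice `Aℤ_pⁿ` in `ℤ_pⁿ` is
`|det A|_p⁻¹`. [folklore] -/
theorem padicInt_pi_volume_range_mulVec [DecidableEq ι] {A : Matrix ι ι ℤ_[p]} (hA : A.det ≠ 0) :
    volume (range fun v : ι → ℤ_[p] ↦ A.mulVec v) = (‖A.det‖₊ : ℝ≥0∞) := by
  rw [← image_univ, padicInt_pi_volume_image_mulVec hA, volume_pi]
  simp

end Literature.MeasureTheory.Group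

end
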